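import Mathlib
import HarnessLib
import Literature.Combinatorics.SimpleGraph.ChordalGraph

/-!
# Interval graphs are chordal (Hajós; Golumbic, Prop. 1.2); band and arrow patterns

Topic `Literature/Combinatorics/SimpleGraph`.  Twenty-third file of the chordal series.
An INTERVAL REPRESENTATION of a graph `G` assigns to every vertex `v` a closed interval
`I_v = [a v, b v]` of a linearly ordered set so that `u ∼ v ⟺ u ≠ v ∧ I_u ∩ I_v ≠ ∅`; an INTERVAL
GRAPH is a graph with an interval representation by real intervals [Golumbic, *Algorithmic Graph
Theory and Perfect Graphs*, §1.1].  [Golumbic, Prop. 1.2 (Hajós 1957)]: "An interval graph satisfies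
the triangulated graph property", i.e. is chordal.  The proof recorded here is the RIGHT-ENDPOINT
ELIMINATION ORDERING: order the vertices by the right endpoints `b v` (ties broken arbitrarily);
if `u` precedes two of its neighbours `v, w`, then `b u ∈ I_v ∩ I_w`, so `v ∼ w` — the ordering is a
perfect elimination ordering (the ordered graph is monotone transitive), hence `G` is chordal
(`isChordal_of_monotoneTransitive` of `ChordalGraph`, [VA15, §4.1]).  As corollaries, the two
standard families of chordal SPARSITY PATTERNS of numerical linear algebra — BAND patterns
(`|i - j| ≤ w`) and ARROW patterns (a dense leading block of `k` rows/columns plus the diagonal) —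
are interval graphs on `Fin n` and therefore chordal ["Band and block-arrow sparsity patterns are
two examples of chordal structure", Andersen–Dahl–Vandenberghe 2010, §2].

## Contents

* `isChordal_of_intervalRepresentation` — a finite graph with an interval representation over ANY
  linear order is chordal [Golumbic, Prop. 1.2].
* `IsIntervalGraph`, `IsIntervalGraph.induce` (hereditary, [Golumbic, Prop. 1.1]),
  `IsIntervalGraph.isChordal` [Golumbic, Prop. 1.2].
* `isChordal_of_adj_iff_band` — the band pattern of half-bandwidth `w` on `Fin n` is chordal;
  `isChordal_of_adj_iff_arrow` — the arrow pattern with a leading block of width `k` is chordal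
  [AndersenDahlVandenberghe2010, §2].

## References

* [Golumbic1980] M. C. Golumbic, *Algorithmic Graph Theory and Perfect Graphs*, Academic Press
  (1980); 2nd ed. (2004), §1.1, Prop. 1.1, Prop. 1.2 (Hajós [1957]).  Read: galaxy
  `panama:327388177104967`, chunks 24–25.
* [VandenbergheAndersen2015] L. Vandenberghe, M. S. Andersen, *Chordal Graphs and Semidefinite
  Optimization*, Found. Trends Optim. 1 (2015), §4.1 (monotone transitivity ⟹ chordal; via
  `ChordalGraph`).
* [AndersenDahlVandenberghe2010] M. S. Andersen, J. Dahl, L. Vandenberghe, *Implementation of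
  nonsymmetric interior-point methods for linear optimization over sparse matrix cones*,
  Math. Program. Comput. 2 (2010) 167–201, §2.  Read: corpus `paper:doi-10-1007-s12532-010-0016-2`, chunk 4.
* G. Hajós, *Über eine Art von Graphen*, Intern. Math. Nachr. 11 (1957), Problem 65 (attribution only).
-/

namespace Literature.Combinatorics.SimpleGraph

open _root_.SimpleGraph
open Literature.LinearAlgebra.Matrix.ChordalSparsity (MonotoneTransitive)

variable {V : Type*} {G : _root_.SimpleGraph V}

/-- **A graph with an interval representation is chordal** [Golumbic, Prop. 1.2 (Hajós)], over any
linearly ordered set of endpoints: if `u ∼ v ⟺ u ≠ v ∧ [a u, b u] ∩ [a v, b v] ≠ ∅`, order the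
vertices by right endpoint (ties broken by an enumeration); a vertex preceding two of its neighbours
`v, w` has its right endpoint in both their intervals, so `v ∼ w` — a perfect elimination ordering.
[cite: Golumbic1980, Prop. 1.2] -/
theorem isChordal_of_intervalRepresentation [Finite V] {α : Type*} [LinearOrder α] (a b : V → α)
    (hadj : ∀ u v, G.Adj u v ↔ u ≠ v ∧ (Set.Icc (a u) (b u) ∩ Set.Icc (a v) (b v)).Nonempty) :
    IsChordal G := by
  classical
  obtain ⟨n, ⟨e⟩⟩ := Finite.exists_equiv_fin V
  let key : V → Lex (α × ℕ) := fun v => toLex (b v, (e v : ℕ))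
  have hkey : Function.Injective key := by
    intro u v h
    have h2 : ((e u : ℕ)) = (e v : ℕ) := congrArg (fun p : Lex (α × ℕ) => (ofLex p).2) h
    exact e.injective (Fin.ext h2)
  letI : LinearOrder V := LinearOrder.lift' key hkey
  have hmono : ∀ {u v : V}, u < v → b u ≤ b v := by
    intro u v huv
    have huv' : key u < key v := huv
    rcases Prod.Lex.lt_iff.1 huv' with h | ⟨h, -⟩
    · exact le_of_lt h
    · exact le_of_eq h
  refine isChordal_of_monotoneTransitive (G := G) ?_
  intro i j k hij hik hjk h1 h2
  obtain ⟨-, x, ⟨-, hxbi⟩, hxaj, -⟩ := (hadj i j).1 h1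
  obtain ⟨-, y, ⟨-, hybi⟩, hyak, -⟩ := (hadj i k).1 h2
  refine (hadj j k).2 ⟨hjk, b i, ⟨?_, hmono hij⟩, ⟨?_, hmono hik⟩⟩
  · exact le_trans hxaj hxbi
  · exact le_trans hyak hybi

/-- An INTERVAL GRAPH: some family of closed real intervals `[a v, b v]` represents `G`
(`u ∼ v ⟺ u ≠ v ∧ [a u, b u] ∩ [a v, b v] ≠ ∅`). [cite: Golumbic1980, §1.1] -/
def IsIntervalGraph (G : _root_.SimpleGraph V) : Prop :=
  ∃ a b : V → ℝ, ∀ u v, G.Adj u v ↔ u ≠ v ∧ (Set.Icc (a u) (b u) ∩ Set.Icc (a v) (b v)).Nonempty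

/-- Being an interval graph is hereditary: an induced subgraph of an interval graph is an interval
graph (restrict the representation). [cite: Golumbic1980, Prop. 1.1] -/
theorem IsIntervalGraph.induce (hG : IsIntervalGraph G) (s : Set V) : IsIntervalGraph (G.induce s) := by
  obtain ⟨a, b, h⟩ := hG
  refine ⟨fun v => a v, fun v => b v, fun u v => ?_⟩
  rw [comap_adj, Function.Embedding.coe_subtype, h]
  simp [Subtype.ext_iff]

/-- **Interval graphs are chordal** [Golumbic, Prop. 1.2 (Hajós 1957): "An interval graph satisfies
the triangulated graph property"]. [cite: Golumbic1980, Prop. 1.2] -/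
theorem IsIntervalGraph.isChordal [Finite V] (hG : IsIntervalGraph G) : IsChordal G := by
  obtain ⟨a, b, h⟩ := hG
  exact isChordal_of_intervalRepresentation a b h

/-- **Band sparsity patterns are chordal**: the graph on `Fin n` with `i ∼ j ⟺ i ≠ j ∧ |i - j| ≤ w`
(the aggregate sparsity pattern of a symmetric band matrix of half-bandwidth `w`) has the interval
representation `i ↦ [i, i + w]` in `ℕ`, hence is chordal.
[cite: AndersenDahlVandenberghe2010, §2 ("Band and block-arrow sparsity patterns are two examples of chordal structure")] -/
theorem isChordal_of_adj_iff_band {n : ℕ} (w : ℕ) {G : _root_.SimpleGraph (Fin n)}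
    (h : ∀ i j : Fin n, G.Adj i j ↔ i ≠ j ∧ (i : ℕ) ≤ j + w ∧ (j : ℕ) ≤ i + w) : IsChordal G := by
  refine isChordal_of_intervalRepresentation (α := ℕ) (fun i => (i : ℕ)) (fun i => (i : ℕ) + w) ?_
  intro i j
  rw [h, Set.Icc_inter_Icc, Set.nonempty_Icc, max_le_iff, le_min_iff, le_min_iff]
  constructor
  · rintro ⟨hne, h1, h2⟩
    exact ⟨hne, ⟨by omega, h1⟩, h2, by omega⟩
  · rintro ⟨hne, ⟨-, h1⟩, h2, -⟩
    exact ⟨hne, h1, h2⟩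

/-- **Arrow sparsity patterns are chordal**: the graph on `Fin n` with
`i ∼ j ⟺ i ≠ j ∧ (i < k ∨ j < k)` (a dense leading `k × k` block, dense first `k` rows and columns,
and the diagonal) has the interval representation `i ↦ [0, 2n]` for `i < k` and `i ↦ [n + i, n + i]`
for `i ≥ k`, hence is chordal.
[cite: AndersenDahlVandenberghe2010, §2 ("Band and block-arrow sparsity patterns are two examples of chordal structure")] -/
theorem isChordal_of_adj_iff_arrow {n : ℕ} (k : ℕ) {G : _root_.SimpleGraph (Fin n)}
    (h : ∀ i j : Fin n, G.Adj i j ↔ i ≠ j ∧ ((i : ℕ) < k ∨ (j : ℕ) < k)) : IsChordal G := by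
  refine isChordal_of_intervalRepresentation (α := ℕ)
    (fun i => if (i : ℕ) < k then 0 else n + i) (fun i => if (i : ℕ) < k then 2 * n else n + i) ?_
  intro i j
  rw [h, Set.Icc_inter_Icc, Set.nonempty_Icc, max_le_iff, le_min_iff, le_min_iff]
  have hi := i.isLt
  have hj := j.isLt
  constructor
  · rintro ⟨hne, hk⟩
    refine ⟨hne, ?_⟩
    split_ifs <;> omega
  · rintro ⟨hne, hint⟩
    refine ⟨hne, ?_⟩
    have hne' : (i : ℕ) ≠ j := fun e => hne (Fin.ext e)
    split_ifs at hint <;> omega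

end Literature.Combinatorics.SimpleGraph
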